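import Mathlib
import HarnessLib
import Summits.Langlands.Langlands.Theses.OddResidueBelowFive

/-!
# Birth skeleton (BC3) for crux stmt-Langlands-18715
`Summit.Langlands.Langlands.Theses.OddResidueBelowFive.TwoAdicEisenstein` — line `birth`

THE CRUX (route `route-Langlands-OddResidueBelowFive`, rank 2; certified twin of
`DyadicOddResidue.DyadicEisensteinFM` = stmt-Langlands-18741, grounder note on the item): for every
continuous `ρ : Γ_ℚ → GL₂(ℚ̄₂)` (`FramedGaloisRep ℚ (PadicAlgCl 2) 2`) which is odd, (absolutely)
irreducible, unramified at all but finitely many places, de Rham at the place `v ∋ 2` for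
Fontaine's PINNED datum with multiplicity-free labelled Hodge–Tate weights, and NOT residually
absolutely irreducible (`ρ̄^ss = χ̄₁ ⊕ χ̄₂`, the Eisenstein residue), and for every `ι : ℚ̄₂ ≃ ℂ`,
`hcpt`: an L-algebraic cuspidal `π` of `GL₂(𝔸_ℚ)` Satake–Frobenius compatible with `ρ` at almost
all places.  In print this is the open `p = 2` case of the residually reducible Fontaine–Mazur
theorem over `ℚ` (Skinner–Wiles 1999 / Pan 2022 Thm 1.0.2 / X. Zhang 2024–25: all `p` odd;
Paškūnas–Tung 2021 §1.2: "it seems likely that one can remove the restriction on the prime p").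

## The cut (the route's own TWO-LAYER PLAN for C1, typed): the shape of `ρ|Γ_{ℚ₂}`

Every printed engine for the residually reducible case splits on the LOCAL representation at `p`:
* `ρ|Γ_{ℚ_p}` REDUCIBLE (an invariant line; with de Rham + distinct Hodge–Tate weights this is the
  nearly ordinary shape `( ψ₁εᵏ⁻¹ ∗ ; 0 ψ₂ )` up to twist): Skinner–Wiles, *Residually reducible
  representations and modular forms*, Publ. IHÉS 89 (1999) [doi:10.1007/bf02698855] — `p` ODD
  (the `(+1,−1)`-eigenlines of complex conjugation split the reducible locus; at `p = 2` an
  involution is unipotent mod `2`, landed `Theorems/DyadicEisensteinFM/Negative/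
  OddnessResiduallyInvisible.lean`).  Printed at `p = 2` inside this cell: ONLY the potentially
  crystalline, ordinary, Hodge–Tate `{0,1}`-up-to-Tate-twist sub-cell (Thorne, arXiv:2608.07186,
  Thm D, 7 Aug 2026; named fact `Literature.NumberTheory.Automorphic.
  Thorne2026_fontaineMazurGL2_potCrystallineOrdinary`, classical-newform conclusion) — general
  regular weights `{0, k−1}`, `k > 2`, and potentially semistable non-crystalline `ρ` remain open.
* `ρ|Γ_{ℚ_p}` (absolutely) IRREDUCIBLE: Pan, *The Fontaine–Mazur conjecture in the residually
  reducible case*, JAMS 35 (2022) [arXiv:1901.07166] Thm 1.0.2 — `p` odd (pseudo-deformation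
  patching + Paškūnas's blocks; at `p = 2` the blocks exist by Paškūnas–Tung arXiv:2104.08948
  Thm 1.3/1.4 with "cokernel killed by 2", classicality at every `p` by Pan, arXiv:2209.06366
  Thm 1.1.2), nothing printed at `p = 2` with `ρ̄` reducible.
So the two stubs are the two GENUINE open halves of the crux at `p = 2`, each with its own engine
and its own named obstruction; neither is bookkeeping and neither gives the crux alone (BC3 probes
`stub → TwoAdicEisenstein`, `stub → Langlands` by `first | exact? | simpa | aesop` — and, unfolded,
by `exact?`, `aesop`, `simpa using h`, `tauto` separately — all FAIL; the positive controls
`TwoAdicEisenstein → stub` elaborate; table in `Lines/birth.md`, probe files attached as evidence).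

## Stubs (2) and composition

* `stub_nearlyOrdinaryCell`  — the crux for `ρ` with `ρ|Γ_{ℚ₂}` REDUCIBLE
  (`¬ ∀ v ∋ 2, FramedRep.IsIrreducible (ρ.toLocal v)`; the place above `2` is unique, landed
  `Theorems/DyadicOddResidueDyadicEisensteinFMUniquePrimeAbove.lean`).  2-adic Skinner–Wiles /
  Hida-family cell; hardest (rank-2 reason of the route: no c-eigenlines mod 2).
* `stub_locallyIrreducibleCell` — the crux for `ρ` with `ρ|Γ_{ℚ₂}` IRREDUCIBLE
  (`∀ v ∋ 2, FramedRep.IsIrreducible (ρ.toLocal v)`).  2-adic Pan cell.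
* `TwoAdicEisenstein_of (hNO : _Goal.stub_nearlyOrdinaryCell) (hLI : _Goal.stub_locallyIrreducibleCell) :
  TwoAdicEisenstein` — kernel-checked, no `sorry`,
  axioms `[propext, Classical.choice, Quot.sound]`: classical `by_cases` on local irreducibility;
  the hypotheses are the two stub STATEMENTS by name (`_Goal.stub_*`, verbatim the types of the
  registered `stub_*` theorems — `Iff.rfl` examples), the conclusion is the route decl by name.
The local hypothesis is typed exactly as the route types it at `p = 3` in `ThreeAdicSmallImage`
(`FramedRep.IsIrreducible (ρ.toLocal v)` under the binder `hv : (3 : 𝓞 ℚ) ∈ v.asIdeal`), with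
`3 ↦ 2`; over the algebraically closed field `ℚ̄₂` irreducible = absolutely irreducible.

## Disproof used

No `Cruxes/TwoAdicEisenstein/Disproof.lean` exists yet (no workfiles on this crux).  The twin's
`Cruxes/DyadicEisensteinFM/Disproof.lean` (cdisprove cycle 1): NO KILL, no `_false_without_`
theorem, `-- Targets: none`; §3 finds every hypothesis of the crux load-bearing — both stubs KEEP
all six hypotheses verbatim (nothing dropped, so no landed `Negative/` lemma —
`OddnessResiduallyInvisible`, `ConclusionForcesUnramified`, `ResidualCharactersAtTwo`,
`EisensteinResidueTraceCriterion` — refutes an instance of either stub); §0 (oddness residually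
invisible at `2`) is honoured as the named obstruction of `stub_nearlyOrdinaryCell`.
-/

set_option linter.dupNamespace false
set_option linter.unusedVariables false

namespace Summit.Langlands.Langlands.Cruxes.TwoAdicEisenstein.Birth

open Summit.Langlands.Langlands.Theses.OddResidueBelowFive

/-! ## 1. The open stubs (registered; `sorry` lives ONLY here) -/

/-- **STUB NO — the nearly ordinary (locally reducible) cell.**  The crux `TwoAdicEisenstein` for
those `ρ` whose restriction to the decomposition group at the place above `2` is REDUCIBLE (has an
invariant line over `ℚ̄₂`): odd, irreducible, a.e. unramified, de Rham at `2` (pinned datum) with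
distinct labelled Hodge–Tate weights, `ρ̄^ss` reducible, `ρ|Γ_{ℚ₂}` reducible ⟹ automorphic a.e.
Engine in print for `p` odd only: Skinner–Wiles 1999 (doi:10.1007/bf02698855), Skinner–Wiles 2001
(doi:10.5802/afst.988), Pan 2022 §6; at `p = 2` the potentially crystalline parallel-weight
sub-cell is Thorne 2026 Thm D (arXiv:2608.07186; named fact
`Thorne2026_fontaineMazurGL2_potCrystallineOrdinary`).  Why it might fail / why it is hard: complex
conjugation is unipotent mod `2`, so the Skinner–Wiles splitting of the reducible locus of the
nearly ordinary Hecke algebra by c-eigenlines has no printed substitute; Hida families at `2` with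
Eisenstein residue.  Size: XL (open in print beyond Thorne's sub-cell). -/
theorem stub_nearlyOrdinaryCell :
    ∀ (ρ : Literature.NumberTheory.GaloisRepresentations.FramedGaloisRep ℚ (PadicAlgCl 2) 2),
      ρ.IsOdd → ρ.toGaloisRep.IsIrreducible →
      (∀ᶠ v : IsDedekindDomain.HeightOneSpectrum (NumberField.RingOfIntegers ℚ) in Filter.cofinite,
        ρ.IsUnramifiedAt v) →
      (∀ (v : IsDedekindDomain.HeightOneSpectrum (NumberField.RingOfIntegers ℚ))
        (hv : ((2 : ℕ) : NumberField.RingOfIntegers ℚ) ∈ v.asIdeal),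
        (Literature.NumberTheory.PAdicHodge.fontainePstAdicCompletion v 2 hv).IsDeRhamFramed
            (ρ.toLocal v) ∧
          ∀ τ : v.adicCompletion ℚ →+* PadicAlgCl 2, Continuous τ →
            (ρ.labelledHodgeTateWeightsAt v
              (Literature.NumberTheory.PAdicHodge.fontainePstAdicCompletion v 2 hv).algebra
              (Literature.NumberTheory.PAdicHodge.fontainePstAdicCompletion v 2 hv).𝔅 τ).Nodup) →
      ¬ ρ.IsResiduallyAbsIrreducible →
      ¬ (∀ (v : IsDedekindDomain.HeightOneSpectrum (NumberField.RingOfIntegers ℚ))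
          (hv : ((2 : ℕ) : NumberField.RingOfIntegers ℚ) ∈ v.asIdeal),
          Literature.NumberTheory.GaloisRepresentations.FramedRep.IsIrreducible (ρ.toLocal v)) →
      ∀ (ι : PadicAlgCl 2 ≃+* ℂ)
        (hcpt : Literature.NumberTheory.Automorphic.isCompact_glFiniteIntegralLevel 2 ℚ),
        ∃ π : Literature.NumberTheory.Automorphic.CuspidalAutomorphicRepData 2 ℚ hcpt,
          π.1.IsLAlgebraic ∧
            ∀ᶠ v : IsDedekindDomain.HeightOneSpectrum (NumberField.RingOfIntegers ℚ) in
              Filter.cofinite, Summit.Langlands.SatakeFrobCompatibleAt ι π.1 ρ v := by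
  sorry

/-- **STUB LI — the locally irreducible cell.**  The crux `TwoAdicEisenstein` for those `ρ` whose
restriction to the decomposition group at the place above `2` is (absolutely) IRREDUCIBLE: odd,
irreducible, a.e. unramified, de Rham at `2` (pinned datum) with distinct labelled Hodge–Tate
weights, `ρ̄^ss` reducible, `ρ|Γ_{ℚ₂}` irreducible ⟹ automorphic a.e.  Engine in print for `p` odd
only: Pan 2022 Thm 1.0.2 (arXiv:1901.07166; pseudo-deformation rings, Taylor–Wiles patching of
completed cohomology at nice primes, Paškūnas's projective envelopes), with the `p = 2` local
inputs now available (Paškūnas–Tung arXiv:2104.08948 Thms 1.3/1.4: blocks and `Z_𝔅 ⊇ (R^ps)_tf`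
with cokernel killed by `2`; Pan arXiv:2209.06366 Thm 1.1.2: classicality at every `p`).  Why it
might fail / why it is hard: Pan's `dim 𝕋 ≥ 3` and the existence of nice primes use the
non-scalar action of complex conjugation mod `p`; at `p = 2`, `Z_𝔅 ⊋ (R^ps)_tf` is possible.
Size: XL (open in print). -/
theorem stub_locallyIrreducibleCell :
    ∀ (ρ : Literature.NumberTheory.GaloisRepresentations.FramedGaloisRep ℚ (PadicAlgCl 2) 2),
      ρ.IsOdd → ρ.toGaloisRep.IsIrreducible →
      (∀ᶠ v : IsDedekindDomain.HeightOneSpectrum (NumberField.RingOfIntegers ℚ) in Filter.cofinite,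
        ρ.IsUnramifiedAt v) →
      (∀ (v : IsDedekindDomain.HeightOneSpectrum (NumberField.RingOfIntegers ℚ))
        (hv : ((2 : ℕ) : NumberField.RingOfIntegers ℚ) ∈ v.asIdeal),
        (Literature.NumberTheory.PAdicHodge.fontainePstAdicCompletion v 2 hv).IsDeRhamFramed
            (ρ.toLocal v) ∧
          ∀ τ : v.adicCompletion ℚ →+* PadicAlgCl 2, Continuous τ →
            (ρ.labelledHodgeTateWeightsAt v
              (Literature.NumberTheory.PAdicHodge.fontainePstAdicCompletion v 2 hv).algebra
              (Literature.NumberTheory.PAdicHodge.fontainePstAdicCompletion v 2 hv).𝔅 τ).Nodup) →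
      ¬ ρ.IsResiduallyAbsIrreducible →
      (∀ (v : IsDedekindDomain.HeightOneSpectrum (NumberField.RingOfIntegers ℚ))
          (hv : ((2 : ℕ) : NumberField.RingOfIntegers ℚ) ∈ v.asIdeal),
          Literature.NumberTheory.GaloisRepresentations.FramedRep.IsIrreducible (ρ.toLocal v)) →
      ∀ (ι : PadicAlgCl 2 ≃+* ℂ)
        (hcpt : Literature.NumberTheory.Automorphic.isCompact_glFiniteIntegralLevel 2 ℚ),
        ∃ π : Literature.NumberTheory.Automorphic.CuspidalAutomorphicRepData 2 ℚ hcpt,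
          π.1.IsLAlgebraic ∧
            ∀ᶠ v : IsDedekindDomain.HeightOneSpectrum (NumberField.RingOfIntegers ℚ) in
              Filter.cofinite, Summit.Langlands.SatakeFrobCompatibleAt ι π.1 ρ v := by
  sorry

/-! ## 2. The stub statements BY NAME (layer invariant of `#h21_check_skeleton`: the composition's
hypotheses must be registered obligations / declared stubs by name — pattern of
`Cruxes/AdjointLiftingGL3/Lines/birth.lean`).  Each `_Goal.stub_x` is VERBATIM the statement of
the theorem `stub_x` above; the `example`s certify the definitional agreement. -/

namespace _Goal

/-- Statement of `stub_nearlyOrdinaryCell` (verbatim), as a proposition by name. -/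
def stub_nearlyOrdinaryCell : Prop :=
    ∀ (ρ : Literature.NumberTheory.GaloisRepresentations.FramedGaloisRep ℚ (PadicAlgCl 2) 2),
      ρ.IsOdd → ρ.toGaloisRep.IsIrreducible →
      (∀ᶠ v : IsDedekindDomain.HeightOneSpectrum (NumberField.RingOfIntegers ℚ) in Filter.cofinite,
        ρ.IsUnramifiedAt v) →
      (∀ (v : IsDedekindDomain.HeightOneSpectrum (NumberField.RingOfIntegers ℚ))
        (hv : ((2 : ℕ) : NumberField.RingOfIntegers ℚ) ∈ v.asIdeal),
        (Literature.NumberTheory.PAdicHodge.fontainePstAdicCompletion v 2 hv).IsDeRhamFramed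
            (ρ.toLocal v) ∧
          ∀ τ : v.adicCompletion ℚ →+* PadicAlgCl 2, Continuous τ →
            (ρ.labelledHodgeTateWeightsAt v
              (Literature.NumberTheory.PAdicHodge.fontainePstAdicCompletion v 2 hv).algebra
              (Literature.NumberTheory.PAdicHodge.fontainePstAdicCompletion v 2 hv).𝔅 τ).Nodup) →
      ¬ ρ.IsResiduallyAbsIrreducible →
      ¬ (∀ (v : IsDedekindDomain.HeightOneSpectrum (NumberField.RingOfIntegers ℚ))
          (hv : ((2 : ℕ) : NumberField.RingOfIntegers ℚ) ∈ v.asIdeal),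
          Literature.NumberTheory.GaloisRepresentations.FramedRep.IsIrreducible (ρ.toLocal v)) →
      ∀ (ι : PadicAlgCl 2 ≃+* ℂ)
        (hcpt : Literature.NumberTheory.Automorphic.isCompact_glFiniteIntegralLevel 2 ℚ),
        ∃ π : Literature.NumberTheory.Automorphic.CuspidalAutomorphicRepData 2 ℚ hcpt,
          π.1.IsLAlgebraic ∧
            ∀ᶠ v : IsDedekindDomain.HeightOneSpectrum (NumberField.RingOfIntegers ℚ) in
              Filter.cofinite, Summit.Langlands.SatakeFrobCompatibleAt ι π.1 ρ v

/-- Statement of `stub_locallyIrreducibleCell` (verbatim), as a proposition by name. -/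
def stub_locallyIrreducibleCell : Prop :=
    ∀ (ρ : Literature.NumberTheory.GaloisRepresentations.FramedGaloisRep ℚ (PadicAlgCl 2) 2),
      ρ.IsOdd → ρ.toGaloisRep.IsIrreducible →
      (∀ᶠ v : IsDedekindDomain.HeightOneSpectrum (NumberField.RingOfIntegers ℚ) in Filter.cofinite,
        ρ.IsUnramifiedAt v) →
      (∀ (v : IsDedekindDomain.HeightOneSpectrum (NumberField.RingOfIntegers ℚ))
        (hv : ((2 : ℕ) : NumberField.RingOfIntegers ℚ) ∈ v.asIdeal),
        (Literature.NumberTheory.PAdicHodge.fontainePstAdicCompletion v 2 hv).IsDeRhamFramed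
            (ρ.toLocal v) ∧
          ∀ τ : v.adicCompletion ℚ →+* PadicAlgCl 2, Continuous τ →
            (ρ.labelledHodgeTateWeightsAt v
              (Literature.NumberTheory.PAdicHodge.fontainePstAdicCompletion v 2 hv).algebra
              (Literature.NumberTheory.PAdicHodge.fontainePstAdicCompletion v 2 hv).𝔅 τ).Nodup) →
      ¬ ρ.IsResiduallyAbsIrreducible →
      (∀ (v : IsDedekindDomain.HeightOneSpectrum (NumberField.RingOfIntegers ℚ))
          (hv : ((2 : ℕ) : NumberField.RingOfIntegers ℚ) ∈ v.asIdeal),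
          Literature.NumberTheory.GaloisRepresentations.FramedRep.IsIrreducible (ρ.toLocal v)) →
      ∀ (ι : PadicAlgCl 2 ≃+* ℂ)
        (hcpt : Literature.NumberTheory.Automorphic.isCompact_glFiniteIntegralLevel 2 ℚ),
        ∃ π : Literature.NumberTheory.Automorphic.CuspidalAutomorphicRepData 2 ℚ hcpt,
          π.1.IsLAlgebraic ∧
            ∀ᶠ v : IsDedekindDomain.HeightOneSpectrum (NumberField.RingOfIntegers ℚ) in
              Filter.cofinite, Summit.Langlands.SatakeFrobCompatibleAt ι π.1 ρ v

end _Goal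

/-- Agreement check: the named statement IS the type of the registered stub (term-mode, by `id`). -/
example : _Goal.stub_nearlyOrdinaryCell ↔
    (∀ (ρ : Literature.NumberTheory.GaloisRepresentations.FramedGaloisRep ℚ (PadicAlgCl 2) 2),
      ρ.IsOdd → ρ.toGaloisRep.IsIrreducible →
      (∀ᶠ v : IsDedekindDomain.HeightOneSpectrum (NumberField.RingOfIntegers ℚ) in Filter.cofinite,
        ρ.IsUnramifiedAt v) →
      (∀ (v : IsDedekindDomain.HeightOneSpectrum (NumberField.RingOfIntegers ℚ))
        (hv : ((2 : ℕ) : NumberField.RingOfIntegers ℚ) ∈ v.asIdeal),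
        (Literature.NumberTheory.PAdicHodge.fontainePstAdicCompletion v 2 hv).IsDeRhamFramed
            (ρ.toLocal v) ∧
          ∀ τ : v.adicCompletion ℚ →+* PadicAlgCl 2, Continuous τ →
            (ρ.labelledHodgeTateWeightsAt v
              (Literature.NumberTheory.PAdicHodge.fontainePstAdicCompletion v 2 hv).algebra
              (Literature.NumberTheory.PAdicHodge.fontainePstAdicCompletion v 2 hv).𝔅 τ).Nodup) →
      ¬ ρ.IsResiduallyAbsIrreducible →
      ¬ (∀ (v : IsDedekindDomain.HeightOneSpectrum (NumberField.RingOfIntegers ℚ))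
          (hv : ((2 : ℕ) : NumberField.RingOfIntegers ℚ) ∈ v.asIdeal),
          Literature.NumberTheory.GaloisRepresentations.FramedRep.IsIrreducible (ρ.toLocal v)) →
      ∀ (ι : PadicAlgCl 2 ≃+* ℂ)
        (hcpt : Literature.NumberTheory.Automorphic.isCompact_glFiniteIntegralLevel 2 ℚ),
        ∃ π : Literature.NumberTheory.Automorphic.CuspidalAutomorphicRepData 2 ℚ hcpt,
          π.1.IsLAlgebraic ∧
            ∀ᶠ v : IsDedekindDomain.HeightOneSpectrum (NumberField.RingOfIntegers ℚ) in
              Filter.cofinite, Summit.Langlands.SatakeFrobCompatibleAt ι π.1 ρ v) :=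
  Iff.rfl

/-- Agreement check: the named statement IS the type of the registered stub (term-mode, by `id`). -/
example : _Goal.stub_locallyIrreducibleCell ↔
    (∀ (ρ : Literature.NumberTheory.GaloisRepresentations.FramedGaloisRep ℚ (PadicAlgCl 2) 2),
      ρ.IsOdd → ρ.toGaloisRep.IsIrreducible →
      (∀ᶠ v : IsDedekindDomain.HeightOneSpectrum (NumberField.RingOfIntegers ℚ) in Filter.cofinite,
        ρ.IsUnramifiedAt v) →
      (∀ (v : IsDedekindDomain.HeightOneSpectrum (NumberField.RingOfIntegers ℚ))
        (hv : ((2 : ℕ) : NumberField.RingOfIntegers ℚ) ∈ v.asIdeal),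
        (Literature.NumberTheory.PAdicHodge.fontainePstAdicCompletion v 2 hv).IsDeRhamFramed
            (ρ.toLocal v) ∧
          ∀ τ : v.adicCompletion ℚ →+* PadicAlgCl 2, Continuous τ →
            (ρ.labelledHodgeTateWeightsAt v
              (Literature.NumberTheory.PAdicHodge.fontainePstAdicCompletion v 2 hv).algebra
              (Literature.NumberTheory.PAdicHodge.fontainePstAdicCompletion v 2 hv).𝔅 τ).Nodup) →
      ¬ ρ.IsResiduallyAbsIrreducible →
      (∀ (v : IsDedekindDomain.HeightOneSpectrum (NumberField.RingOfIntegers ℚ))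
          (hv : ((2 : ℕ) : NumberField.RingOfIntegers ℚ) ∈ v.asIdeal),
          Literature.NumberTheory.GaloisRepresentations.FramedRep.IsIrreducible (ρ.toLocal v)) →
      ∀ (ι : PadicAlgCl 2 ≃+* ℂ)
        (hcpt : Literature.NumberTheory.Automorphic.isCompact_glFiniteIntegralLevel 2 ℚ),
        ∃ π : Literature.NumberTheory.Automorphic.CuspidalAutomorphicRepData 2 ℚ hcpt,
          π.1.IsLAlgebraic ∧
            ∀ᶠ v : IsDedekindDomain.HeightOneSpectrum (NumberField.RingOfIntegers ℚ) in
              Filter.cofinite, Summit.Langlands.SatakeFrobCompatibleAt ι π.1 ρ v) :=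
  Iff.rfl

/-! ## 3. The composition (kernel-checked, no `sorry`) -/

/-- **Composition.**  The two cells exhaust the crux: for a given `ρ` either `ρ|Γ_{ℚ_v}` is
irreducible at every place `v ∋ 2` (there is exactly one) — cell LI — or not — cell NO.  Classical
`by_cases`; the hypotheses of `TwoAdicEisenstein` are threaded verbatim.  Hypotheses: the two
declared stubs BY NAME (`_Goal.stub_*`); conclusion: the route decl
`Summit.Langlands.Langlands.Theses.OddResidueBelowFive.TwoAdicEisenstein` BY NAME. -/
theorem TwoAdicEisenstein_of (hNO : _Goal.stub_nearlyOrdinaryCell)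
    (hLI : _Goal.stub_locallyIrreducibleCell) : TwoAdicEisenstein := by
  unfold _Goal.stub_nearlyOrdinaryCell at hNO
  unfold _Goal.stub_locallyIrreducibleCell at hLI
  intro ρ hodd hirr hur hdR hres ι hcpt
  by_cases hloc : ∀ (v : IsDedekindDomain.HeightOneSpectrum (NumberField.RingOfIntegers ℚ))
      (hv : ((2 : ℕ) : NumberField.RingOfIntegers ℚ) ∈ v.asIdeal),
      Literature.NumberTheory.GaloisRepresentations.FramedRep.IsIrreducible (ρ.toLocal v)
  · exact hLI ρ hodd hirr hur hdR hres hloc ι hcpt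
  · exact hNO ρ hodd hirr hur hdR hres hloc ι hcpt

end Summit.Langlands.Langlands.Cruxes.TwoAdicEisenstein.Birth
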